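import Summits.CriticalPhenomena.PercolationContinuityZ3.Theses.PercLowPointHalfSpace
import Summits.CriticalPhenomena.PercolationContinuityZ3.Theorems.PercLowPointHalfSpaceQuantitativeBGNFloorDefs
import Summits.CriticalPhenomena.PercolationContinuityZ3.Theorems.PercLowPointHalfSpaceQuantitativeBGNFloorDepthMono
import Summits.CriticalPhenomena.PercolationContinuityZ3.Theorems.PercLowPointHalfSpaceQuantitativeBGNFloorNoFloor
import Summits.CriticalPhenomena.PercolationContinuityZ3.Theorems.PercLowPointHalfSpaceQuantitativeBGNFloorRussoCalc
import Summits.CriticalPhenomena.PercolationContinuityZ3.Theorems.PercLowPointHalfSpaceQuantitativeBGNFloorDeriv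
import Mathlib.Analysis.SpecialFunctions.Pow.Real
import HarnessLib

/-!
# `QuantitativeBGN` (stmt-CriticalPhenomena-0913), line `microscopic-floor-doubling-gain` — the transfer

Crux `Summit.CriticalPhenomena.PercolationContinuityZ3.Theses.PercLowPointHalfSpace.QuantitativeBGN` (a polynomial rate
for the boundary one-arm probability at `p_c(ℤ³)`), line `microscopic-floor-doubling-gain` (skeleton
`Cruxes/QuantitativeBGN/Lines/microscopic_floor_doubling_gain.lean`, lead c2). This file is the kernel-checked
COMPOSITION of the line from its landed stubs, stated without any `def … : Prop`:

* `floorRusso` — the integrated one-sided Russo inequality in the floor density,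
  `f_j(0) · exp(I_j) ≤ γ_r(j)` with `I_j = floorLogGain r j = ∫₀¹ p_c g_j/f_j`, from the landed
  `stub_floorDeriv` (readback, continuity, `f_j' = p_c g_j` on `(0,1)`) and `stub_russoCalc` (FTC for `log f_j`);
* `floorGain_of_pivotalFloorDensity` — telescoping `γ_r(j) e^{I_{j+1}} ≤ f_{j+1}(0) e^{I_{j+1}} ≤ γ_r(j+1)`
  (landed `stub_noFloor` + `floorRusso`) over a dyadic block: a uniform lower bound `Σ_{j∈(h,2h]} I_j ≥ κ'` on the
  window `h₀ ≤ h ≤ r^δ/2` gives the UNIFORM MICROSCOPIC FLOOR-DOUBLING GAIN `γ_r(2h) ≥ e^{κ'} γ_r(h)` there;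
* `quantitativeBGN_of_floorGain` — the dyadic iteration: a uniform gain `γ_r(2h) ≥ (1+κ)γ_r(h)` for
  `h₀ ≤ h ≤ r^δ/2` gives `γ_r(0) ≤ γ_r(h₀) ≤ (1+κ)·h₀^{log₂(1+κ)} · r^{-δ log₂(1+κ)}` (landed `stub_depthMono` for
  `γ_r(0) ≤ γ_r(h₀)`, `γ ≤ 1` at the top of the window), i.e. the crux with `a = δ log₂(1+κ)`;
* `quantitativeBGN_of_pivotalFloorDensity` — the two together: the crux follows from the line's ONE open
  statement, the registered stub `stub_pivotalFloorDensity` (taken as a hypothesis, spelled out).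

So the tree now holds a third reduction of the crux (after `γ₁ < 2 ⇒ crux`, p91667, and
`MirrorNonCoalescenceRel ⇒ crux`, p122580): `PivotalFloorDensity ⇒ FloorGain ⇒ QuantitativeBGN`. The open input is
a uniform-in-`r`, local-in-depth sensitivity statement for ONE critical half-space arm (false above `p_c`, where
`γ_r(1) ≥ θ_H(p) > 0` forbids any uniform gain; `Negative.quantitativeBGNAt_false_of_criticalProb_lt`).
-/

noncomputable section

namespace Summit.CriticalPhenomena.PercolationContinuityZ3.Theorems

open MeasureTheory Literature.Probability.Percolation Literature.Probability.LatticeModels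
open FloorDoubling

namespace FloorTransfer

/-- **Integrated Russo inequality in the floor density**: `f_j(0) · exp(I_j) ≤ γ_r(j)` — the calculus lemma
`stub_russoCalc` applied to `f = f_j ∘ projIcc`, `g = p_c · g_j ∘ projIcc`, whose hypotheses are `stub_floorDeriv`.
[folklore] -/
theorem floorRusso (r j : ℕ) : armProbFloor r j 0 * Real.exp (floorLogGain r j) ≤ gammaR r j := by
  obtain ⟨hone, hcontf, hcontg, hderiv⟩ := stub_floorDeriv r j
  have hpc0 : (0 : ℝ) ≤ (criticalProbI 3 : ℝ) := (criticalProbI 3).2.1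
  have key := stub_russoCalc (fun t => armProbFloor r j (Set.projIcc (0 : ℝ) 1 zero_le_one t))
    (fun t => (criticalProbI 3 : ℝ) * pivotalFloorSum r j (Set.projIcc (0 : ℝ) 1 zero_le_one t))
    hcontf (continuous_const.mul hcontg) (fun t => armProbFloor_nonneg _ _ _)
    (fun t => mul_nonneg hpc0 (pivotalFloorSum_nonneg _ _ _)) hderiv
  have h0 : armProbFloor r j (Set.projIcc (0 : ℝ) 1 zero_le_one 0) = armProbFloor r j 0 := by
    simp only [Set.projIcc_left]; rfl
  have h1 : armProbFloor r j (Set.projIcc (0 : ℝ) 1 zero_le_one 1) = gammaR r j := by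
    simp only [Set.projIcc_right]; exact hone
  simp only [h0, h1] at key
  exact key

/-- One telescoping step: `γ_r(j) · e^{I_{j+1}} ≤ γ_r(j+1)` (landed `stub_noFloor` then `floorRusso`). [folklore] -/
theorem gammaR_mul_exp_le_succ (r j : ℕ) :
    gammaR r j * Real.exp (floorLogGain r (j + 1)) ≤ gammaR r (j + 1) :=
  le_trans (mul_le_mul_of_nonneg_right (stub_noFloor r j) (Real.exp_nonneg _)) (floorRusso r (j + 1))

/-- Telescoped: `γ_r(h) · exp(Σ_{j ∈ (h, h+n]} I_j) ≤ γ_r(h+n)`. [folklore] -/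
theorem gammaR_mul_exp_sum_le (r h n : ℕ) :
    gammaR r h * Real.exp (∑ j ∈ Finset.Ioc h (h + n), floorLogGain r j) ≤ gammaR r (h + n) := by
  induction n with
  | zero => simp
  | succ n ih =>
    rw [← add_assoc, Finset.sum_Ioc_succ_top (by omega : h ≤ h + n), Real.exp_add, ← mul_assoc]
    exact le_trans (mul_le_mul_of_nonneg_right ih (Real.exp_nonneg _)) (gammaR_mul_exp_le_succ r (h + n))

/-- **Pivotal-floor density ⟹ uniform floor-doubling gain.** If `Σ_{j∈(h,2h]} I_j ≥ κ'` for all `h₀ ≤ h`,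
`2h ≤ r^δ`, then `e^{κ'} γ_r(h) ≤ γ_r(2h)` on the same window. [folklore] -/
theorem floorGain_of_pivotalFloorDensity {κ' δ : ℝ} {h₀ : ℕ}
    (hden : ∀ r h : ℕ, h₀ ≤ h → ((2 * h : ℕ) : ℝ) ≤ (r : ℝ) ^ δ →
      κ' ≤ ∑ j ∈ Finset.Ioc h (2 * h), floorLogGain r j)
    (r h : ℕ) (hh : h₀ ≤ h) (hwin : ((2 * h : ℕ) : ℝ) ≤ (r : ℝ) ^ δ) :
    Real.exp κ' * gammaR r h ≤ gammaR r (2 * h) := by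
  have key := gammaR_mul_exp_sum_le r h h
  rw [← two_mul] at key
  calc Real.exp κ' * gammaR r h = gammaR r h * Real.exp κ' := mul_comm _ _
    _ ≤ gammaR r h * Real.exp (∑ j ∈ Finset.Ioc h (2 * h), floorLogGain r j) :=
        mul_le_mul_of_nonneg_left (Real.exp_le_exp.2 (hden r h hh hwin)) (gammaR_nonneg r h)
    _ ≤ gammaR r (2 * h) := key

/-- Iterated gain along the depths `h₀ · 2^j` inside the window. [folklore] -/
theorem iter_gain {κ δ : ℝ} {h₀ : ℕ} (hκ : 0 < κ)
    (hG : ∀ r h : ℕ, h₀ ≤ h → ((2 * h : ℕ) : ℝ) ≤ (r : ℝ) ^ δ →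
      (1 + κ) * gammaR r h ≤ gammaR r (2 * h))
    (r : ℕ) : ∀ j : ℕ, ((h₀ * 2 ^ j : ℕ) : ℝ) ≤ (r : ℝ) ^ δ →
      (1 + κ) ^ j * gammaR r h₀ ≤ gammaR r (h₀ * 2 ^ j) := by
  intro j
  induction j with
  | zero => intro _; simp
  | succ j ih =>
    intro hj
    have hmono_pow : h₀ * 2 ^ j ≤ h₀ * 2 ^ (j + 1) :=
      Nat.mul_le_mul_left h₀ (Nat.pow_le_pow_right (by norm_num) (Nat.le_succ j))
    have hle : ((h₀ * 2 ^ j : ℕ) : ℝ) ≤ (r : ℝ) ^ δ := le_trans (by exact_mod_cast hmono_pow) hj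
    have h1 := ih hle
    have h3 : 2 * (h₀ * 2 ^ j) = h₀ * 2 ^ (j + 1) := by ring
    have h2 : (1 + κ) * gammaR r (h₀ * 2 ^ j) ≤ gammaR r (h₀ * 2 ^ (j + 1)) := by
      rw [← h3]
      refine hG r (h₀ * 2 ^ j) (Nat.le_mul_of_pos_right _ (by positivity)) ?_
      rw [h3]; exact hj
    calc (1 + κ) ^ (j + 1) * gammaR r h₀ = (1 + κ) * ((1 + κ) ^ j * gammaR r h₀) := by ring
      _ ≤ (1 + κ) * gammaR r (h₀ * 2 ^ j) := mul_le_mul_of_nonneg_left h1 (by linarith)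
      _ ≤ gammaR r (h₀ * 2 ^ (j + 1)) := h2

/-- **Uniform floor-doubling gain ⟹ a power law for `γ_r(0)`**, with `a = δ · log₂(1+κ)` and
`C = (1+κ) · h₀^{log₂(1+κ)}`: `γ_r(0) ≤ γ_r(h₀)` (landed `stub_depthMono`) `≤ (1+κ)^{-J}` with
`J = ⌊log₂(r^δ/h₀)⌋` doublings inside the window, and `(1+κ)^{log₂ y} = y^{log₂(1+κ)}`. [folklore] -/
theorem gammaR_zero_le_of_floorGain {κ δ : ℝ} {h₀ : ℕ} (hκ : 0 < κ) (hh₀ : 1 ≤ h₀)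
    (hG : ∀ r h : ℕ, h₀ ≤ h → ((2 * h : ℕ) : ℝ) ≤ (r : ℝ) ^ δ →
      (1 + κ) * gammaR r h ≤ gammaR r (2 * h)) {r : ℕ} (hr : 1 ≤ r) :
    gammaR r 0 ≤ (1 + κ) * (h₀ : ℝ) ^ Real.logb 2 (1 + κ) * (r : ℝ) ^ (-(δ * Real.logb 2 (1 + κ))) := by
  set L : ℝ := Real.logb 2 (1 + κ) with hL
  have hκ1 : (1 : ℝ) < 1 + κ := by linarith
  have hLpos : 0 < L := Real.logb_pos (by norm_num) hκ1
  set a : ℝ := δ * L with ha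
  have hmon : Monotone (gammaR r) := monotone_nat_of_le_succ fun k => stub_depthMono r k
  have hr0 : (0 : ℝ) < r := by exact_mod_cast hr
  have hh0 : (0 : ℝ) < h₀ := by exact_mod_cast hh₀
  have hra : (r : ℝ) ^ a = ((r : ℝ) ^ δ) ^ L := by rw [ha, Real.rpow_mul hr0.le]
  by_cases hwin : (h₀ : ℝ) ≤ (r : ℝ) ^ δ
  · -- the window [h₀, r^δ] contains J = ⌊log₂(r^δ/h₀)⌋ doublings
    set x : ℝ := Real.logb 2 ((r : ℝ) ^ δ / h₀) with hx
    have hx0 : 0 ≤ x := Real.logb_nonneg (by norm_num) (by rwa [le_div_iff₀ hh0, one_mul])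
    set J : ℕ := ⌊x⌋₊ with hJ
    have hJle : (J : ℝ) ≤ x := Nat.floor_le hx0
    have hJgt : x < J + 1 := Nat.lt_floor_add_one x
    have h2x : (2 : ℝ) ^ x = (r : ℝ) ^ δ / h₀ :=
      Real.rpow_logb (by norm_num) (by norm_num) (by positivity)
    have hpow : ((h₀ * 2 ^ J : ℕ) : ℝ) ≤ (r : ℝ) ^ δ := by
      push_cast
      have h2J : (2 : ℝ) ^ (J : ℝ) ≤ 2 ^ x := Real.rpow_le_rpow_of_exponent_le (by norm_num) hJle
      rw [Real.rpow_natCast] at h2J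
      calc (h₀ : ℝ) * 2 ^ J ≤ h₀ * 2 ^ x := mul_le_mul_of_nonneg_left h2J hh0.le
        _ = h₀ * ((r : ℝ) ^ δ / h₀) := by rw [h2x]
        _ = (r : ℝ) ^ δ := by field_simp
    have hchain := iter_gain hκ hG r J hpow
    have hle1 : gammaR r (h₀ * 2 ^ J) ≤ 1 := gammaR_le_one _ _
    have hpowpos : (0 : ℝ) < (1 + κ) ^ J := by positivity
    have hγh₀ : gammaR r h₀ ≤ 1 / (1 + κ) ^ J := by
      rw [le_div_iff₀ hpowpos, mul_comm]
      exact hchain.trans hle1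
    have h1 : (1 + κ) ^ (x - 1) ≤ (1 + κ) ^ J := by
      have := Real.rpow_le_rpow_of_exponent_le hκ1.le (by linarith : x - 1 ≤ (J : ℝ))
      rwa [Real.rpow_natCast] at this
    have h2 : (1 + κ) ^ (x - 1) = (1 + κ) ^ x / (1 + κ) :=
      Real.rpow_sub_one (by positivity) x
    have h3 : (1 + κ) ^ x = (r : ℝ) ^ a / (h₀ : ℝ) ^ L := by
      rw [Real.rpow_def_of_pos (by linarith), Real.rpow_def_of_pos hr0, Real.rpow_def_of_pos hh0,
        ← Real.exp_sub]
      congr 1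
      have hlog2 : Real.log 2 ≠ 0 := by positivity
      rw [hx, ha, hL, Real.logb, Real.logb, Real.log_div (by positivity) (by positivity),
        Real.log_rpow hr0]
      field_simp
    have hxpos : (0 : ℝ) < (1 + κ) ^ (x - 1) := by positivity
    have hrapos : (0 : ℝ) < (r : ℝ) ^ a := by positivity
    have hh0L : (0 : ℝ) < (h₀ : ℝ) ^ L := by positivity
    calc gammaR r 0 ≤ gammaR r h₀ := hmon (Nat.zero_le _)
      _ ≤ 1 / (1 + κ) ^ J := hγh₀
      _ ≤ 1 / (1 + κ) ^ (x - 1) := by gcongr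
      _ = (1 + κ) * (h₀ : ℝ) ^ L / (r : ℝ) ^ a := by
          rw [h2, h3]; field_simp
      _ = (1 + κ) * (h₀ : ℝ) ^ L * (r : ℝ) ^ (-a) := by
          rw [Real.rpow_neg hr0.le, div_eq_mul_inv]
  · -- empty window: the bound is ≥ 1
    have hlt : (r : ℝ) ^ δ < h₀ := lt_of_not_ge hwin
    have hlt' : ((r : ℝ) ^ δ) ^ L < (h₀ : ℝ) ^ L := Real.rpow_lt_rpow (by positivity) hlt hLpos
    have hrapos : (0 : ℝ) < (r : ℝ) ^ a := by positivity
    have hone : (1 : ℝ) ≤ (1 + κ) * (h₀ : ℝ) ^ L * (r : ℝ) ^ (-a) := by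
      rw [Real.rpow_neg hr0.le, hra]
      rw [hra] at hrapos
      have : (1 : ℝ) ≤ (h₀ : ℝ) ^ L * (((r : ℝ) ^ δ) ^ L)⁻¹ := by
        rw [← div_eq_mul_inv, one_le_div hrapos]; exact hlt'.le
      nlinarith [this, hκ, inv_pos.2 hrapos, hlt'.le]
    exact (gammaR_le_one r 0).trans hone

end FloorTransfer

/-- **TRANSFER 1 (uniform floor-doubling gain ⟹ the crux).** If for some `κ, δ > 0` and `h₀ ≥ 1` the critical
depth-indexed arm probability gains a uniform factor per doubling of the depth on the window `h₀ ≤ h ≤ r^δ/2`,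
`(1+κ) γ_r(h) ≤ γ_r(2h)`, then `QuantitativeBGN` holds, with exponent `a = δ log₂(1+κ)`. [folklore] -/
theorem quantitativeBGN_of_floorGain : (∃ κ δ : ℝ, ∃ h₀ : ℕ, 0 < κ ∧ 0 < δ ∧ 1 ≤ h₀ ∧ ∀ r h : ℕ, h₀ ≤ h → ((2 * h : ℕ) : ℝ) ≤ (r : ℝ) ^ δ → (1 + κ) * gammaR r h ≤ gammaR r (2 * h)) → Summit.CriticalPhenomena.PercolationContinuityZ3.Theses.PercLowPointHalfSpace.QuantitativeBGN := by
  rintro ⟨κ, δ, h₀, hκ, hδ, hh₀, hG⟩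
  refine Theorems.QuantitativeBGN.Negative.quantitativeBGN_iff.2
    ⟨δ * Real.logb 2 (1 + κ), (1 + κ) * (h₀ : ℝ) ^ Real.logb 2 (1 + κ),
      mul_pos hδ (Real.logb_pos (by norm_num) (by linarith)), fun r hr => ?_⟩
  rw [← gammaR_zero_eq_armH]
  exact FloorTransfer.gammaR_zero_le_of_floorGain hκ hh₀ hG hr

/-- **TRANSFER 2 (the line's one open stub ⟹ the crux).** The registered open stub `stub_pivotalFloorDensity`
of the line — a uniform lower bound `κ'` for the `s`-integrated conditional count of pivotal FLOOR edges summed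
over every dyadic block of depths `(h, 2h]`, `h₀ ≤ h ≤ r^δ/2` — implies `QuantitativeBGN`
(gain `1 + κ = e^{κ'}`, exponent `a = δ κ'/log 2`). Everything else in the line is landed. [folklore] -/
theorem quantitativeBGN_of_pivotalFloorDensity : (∃ κ' δ : ℝ, ∃ h₀ : ℕ, 0 < κ' ∧ 0 < δ ∧ 1 ≤ h₀ ∧ ∀ r h : ℕ, h₀ ≤ h → ((2 * h : ℕ) : ℝ) ≤ (r : ℝ) ^ δ → κ' ≤ ∑ j ∈ Finset.Ioc h (2 * h), floorLogGain r j) → Summit.CriticalPhenomena.PercolationContinuityZ3.Theses.PercLowPointHalfSpace.QuantitativeBGN := by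
  rintro ⟨κ', δ, h₀, hκ', hδ, hh₀, hden⟩
  refine quantitativeBGN_of_floorGain ⟨Real.exp κ' - 1, δ, h₀, ?_, hδ, hh₀, fun r h hh hwin => ?_⟩
  · have := Real.add_one_lt_exp (ne_of_gt hκ')
    linarith
  · have := FloorTransfer.floorGain_of_pivotalFloorDensity hden r h hh hwin
    convert this using 2; ring

end Summit.CriticalPhenomena.PercolationContinuityZ3.Theorems

end
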